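import Mathlib
import Literature.RingTheory.CohomologyAnnihilator.BirationalTransfer
import HarnessLib

/-!
# Hull / dual / syzygy transfer of stable annihilation (card A2, the four transfer lemmas)

Crux `HomologicalConductor.Persistence` (stmt-ResolutionOfSingularities-16484), chain W4.4b, card A2
`hull-dual-syzygy-extension` of res-L1-w44b-idea-1 (ASSIGN v0.7: "stub-3 successor = the four A2
transfer lemmas in ONE file"). `[OURS · L1 w44b]` — elementary linear algebra about STABLE
ANNIHILATION, i.e. about factorisations `π ∘ ι = x • id` of a homothety through a finite free module
`Fin s → C` (the card's `FactorsThroughFree C M x`, kept UNFOLDED here so that no definition is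
introduced); NOT a statement of the manuscript under review; AI-drafted (weaker than expert review).
By the tree's `smul_ext_eq_zero_of_linearMap_comp_eq_smul_id` (`BirationalTransfer`) such an `x`
kills `Extⁱ_C(M, -)` for all `i ≥ 1` — with EXPONENT ONE, which is the point of the card: the
operations below cost no power of `x`.

* `exists_comp_eq_smul_id_of_retract` — direct summands (retracts) inherit (card A1·S1'
  `SummandLemma`, needed by the hull descent step);
* `exists_comp_eq_smul_id_dual` — **`DualTransfer`**: dualise `π ∘ ι = x • id` and identify
  `(Cˢ)* ≅ Cˢ` (`Pi.basisFun.toDualEquiv`);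
* `exists_comp_eq_smul_id_dual_dual` — **`HullTransfer`**: the reflexive hull `Y**` (twice the dual);
* `exists_comp_eq_smul_id_ker` — **`SyzygyTransfer`**: kernels of surjections `q : Cᵗ → Y` inherit
  (lift `π` through `q` to `π₁`; then `v ↦ x v - π₁ ι q v` maps `Cᵗ` into `ker q` and restricts to
  `x • id` on `ker q`; the free module is `Cᵗ` itself);
* `exists_comp_eq_smul_id_baseChange` — base change `B → C`: `C ⊗_B Y₀ → C ⊗_B Bˢ ≅ Cˢ → C ⊗_B Y₀`
  (the tree's `baseChange_comp_baseChange_eq_smul_id` + `TensorProduct.piScalarRight`);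
* `exists_comp_eq_smul_id_hullDescentStep` — **`HullDescentStep`**: a retract `N` of the reflexive
  hull `(C ⊗_B Y₀)**` of the base change of an `x`-stably-annihilated `B`-module `Y₀` is
  `(algebraMap B C x)`-stably annihilated over `C` (no torsion-freeness, flatness or birationality
  needed for this implication);
* `smul_ext_eq_zero_of_hullDescentStep` — the `Ext` consequence in `ModuleCat C`.
-/

-- single-problem summit: the doubled namespace component is forced
set_option linter.dupNamespace false

noncomputable section

open CategoryTheory CategoryTheory.Abelian Module
open scoped TensorProduct

universe u v

namespace Summit.ResolutionOfSingularities.ResolutionOfSingularities.Theorems.HomologicalConductor.PersistenceHullTransfer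

open Literature.RingTheory.CohomologyAnnihilator

section Transfer

variable {C : Type u} [CommRing C]

/-- **Retracts inherit stable annihilation** (card A1·S1' `SummandLemma`): if `π ∘ ι = x • id_M`
through `Cˢ` and `N` is a retract of `M` (`r ∘ i = id_N`), then `(r ∘ π) ∘ (ι ∘ i) = x • id_N`.
[folklore] -/
theorem exists_comp_eq_smul_id_of_retract {M N : Type*} [AddCommGroup M] [Module C M]
    [AddCommGroup N] [Module C N] {x : C} {s : ℕ} (ι : M →ₗ[C] (Fin s → C))
    (π : (Fin s → C) →ₗ[C] M) (h : π ∘ₗ ι = x • LinearMap.id) (i : N →ₗ[C] M) (r : M →ₗ[C] N)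
    (hri : r ∘ₗ i = LinearMap.id) :
    ∃ (ι' : N →ₗ[C] (Fin s → C)) (π' : (Fin s → C) →ₗ[C] N), π' ∘ₗ ι' = x • LinearMap.id := by
  refine ⟨ι ∘ₗ i, r ∘ₗ π, LinearMap.ext fun n => ?_⟩
  have h1 : π (ι (i n)) = x • i n := LinearMap.congr_fun h (i n)
  have h2 : r (i n) = n := LinearMap.congr_fun hri n
  simp only [LinearMap.comp_apply, LinearMap.smul_apply, LinearMap.id_apply, h1, map_smul, h2]

/-- **`DualTransfer`** (card A2·H1): if `π ∘ ι = x • id_Y` through `Cˢ`, then `x • id_{Y*}` factors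
through `(Cˢ)* ≅ Cˢ`: `ι* ∘ π* = (π ∘ ι)* = (x • id)* = x • id`. [folklore] -/
theorem exists_comp_eq_smul_id_dual {Y : Type*} [AddCommGroup Y] [Module C Y] {x : C} {s : ℕ}
    (ι : Y →ₗ[C] (Fin s → C)) (π : (Fin s → C) →ₗ[C] Y) (h : π ∘ₗ ι = x • LinearMap.id) :
    ∃ (ι' : Dual C Y →ₗ[C] (Fin s → C)) (π' : (Fin s → C) →ₗ[C] Dual C Y),
      π' ∘ₗ ι' = x • LinearMap.id := by
  let e : (Fin s → C) ≃ₗ[C] Dual C (Fin s → C) := (Pi.basisFun C (Fin s)).toDualEquiv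
  refine ⟨e.symm.toLinearMap ∘ₗ π.dualMap, ι.dualMap ∘ₗ e.toLinearMap, ?_⟩
  refine LinearMap.ext fun φ => ?_
  simp only [LinearMap.comp_apply, LinearEquiv.coe_toLinearMap, LinearEquiv.apply_symm_apply,
    LinearMap.smul_apply, LinearMap.id_apply]
  refine LinearMap.ext fun y => ?_
  have hy : π (ι y) = x • y := LinearMap.congr_fun h y
  rw [LinearMap.dualMap_apply, LinearMap.dualMap_apply, hy, map_smul, LinearMap.smul_apply]

/-- **`HullTransfer`** (card A2·H1'): stable annihilation passes to the reflexive hull `Y**`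
(functoriality of the double dual, which fixes `Cˢ`): `DualTransfer` twice. [folklore] -/
theorem exists_comp_eq_smul_id_dual_dual {Y : Type*} [AddCommGroup Y] [Module C Y] {x : C}
    {s : ℕ} (ι : Y →ₗ[C] (Fin s → C)) (π : (Fin s → C) →ₗ[C] Y)
    (h : π ∘ₗ ι = x • LinearMap.id) :
    ∃ (ι' : Dual C (Dual C Y) →ₗ[C] (Fin s → C)) (π' : (Fin s → C) →ₗ[C] Dual C (Dual C Y)),
      π' ∘ₗ ι' = x • LinearMap.id := by
  obtain ⟨ι₁, π₁, h₁⟩ := exists_comp_eq_smul_id_dual ι π h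
  exact exists_comp_eq_smul_id_dual ι₁ π₁ h₁

/-- **`SyzygyTransfer`** (card A2·H1''): kernels of surjections from finite free modules inherit stable
annihilation. If `π ∘ ι = x • id_Y` through `Cˢ` and `q : Cᵗ → Y` is onto, lift `π` to
`π₁ : Cˢ → Cᵗ` (`q ∘ π₁ = π`); then `ψ(v) = x v - π₁ ι q v` maps `Cᵗ` into `ker q`
(`q ψ(v) = x q v - π ι q v = 0`) and `ψ|_{ker q} = x • id`, so `x • id_{ker q}` factors through `Cᵗ`.
[folklore] -/
theorem exists_comp_eq_smul_id_ker {Y : Type*} [AddCommGroup Y] [Module C Y] {x : C} {s : ℕ}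
    (ι : Y →ₗ[C] (Fin s → C)) (π : (Fin s → C) →ₗ[C] Y) (h : π ∘ₗ ι = x • LinearMap.id)
    {t : ℕ} (q : (Fin t → C) →ₗ[C] Y) (hq : Function.Surjective q) :
    ∃ (ι' : LinearMap.ker q →ₗ[C] (Fin t → C)) (π' : (Fin t → C) →ₗ[C] LinearMap.ker q),
      π' ∘ₗ ι' = x • LinearMap.id := by
  obtain ⟨π₁, hπ₁⟩ := Module.projective_lifting_property q π hq
  let ψ : (Fin t → C) →ₗ[C] (Fin t → C) := x • LinearMap.id - π₁ ∘ₗ ι ∘ₗ q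
  have hmem : ∀ v : Fin t → C, ψ v ∈ LinearMap.ker q := fun v => by
    have h1 : q (π₁ (ι (q v))) = π (ι (q v)) := LinearMap.congr_fun hπ₁ (ι (q v))
    have h2 : π (ι (q v)) = x • q v := LinearMap.congr_fun h (q v)
    rw [LinearMap.mem_ker, LinearMap.sub_apply, LinearMap.comp_apply, LinearMap.comp_apply, map_sub,
      h1, h2, LinearMap.smul_apply, LinearMap.id_apply, map_smul, sub_self]
  refine ⟨(LinearMap.ker q).subtype, LinearMap.codRestrict (LinearMap.ker q) ψ hmem,
    LinearMap.ext fun k => Subtype.ext ?_⟩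
  have hk : q (k : Fin t → C) = 0 := k.2
  have hψ : ψ (k : Fin t → C) = x • (k : Fin t → C) := by
    change x • (k : Fin t → C) - π₁ (ι (q (k : Fin t → C))) = x • (k : Fin t → C)
    rw [hk, map_zero, map_zero, sub_zero]
  simp only [LinearMap.comp_apply, LinearMap.codRestrict_apply, Submodule.subtype_apply,
    LinearMap.smul_apply, LinearMap.id_apply, Submodule.coe_smul_of_tower, hψ]

end Transfer

section BaseChange

variable {B : Type u} [CommRing B] (C : Type u) [CommRing C] [Algebra B C]

/-- **Base change of stable annihilation to a free module**: if `π₀ ∘ ι₀ = x • id_{Y₀}` through `Bˢ`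
over `B`, then `(algebraMap B C x) • id_{C ⊗_B Y₀}` factors through `C ⊗_B Bˢ ≅ Cˢ` over `C`
(`baseChange_comp_baseChange_eq_smul_id` + `TensorProduct.piScalarRight`). [folklore] -/
theorem exists_comp_eq_smul_id_baseChange {Y₀ : Type u} [AddCommGroup Y₀] [Module B Y₀] {x : B}
    {s : ℕ} (ι₀ : Y₀ →ₗ[B] (Fin s → B)) (π₀ : (Fin s → B) →ₗ[B] Y₀)
    (h : π₀ ∘ₗ ι₀ = x • LinearMap.id) :
    ∃ (ι : C ⊗[B] Y₀ →ₗ[C] (Fin s → C)) (π : (Fin s → C) →ₗ[C] C ⊗[B] Y₀),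
      π ∘ₗ ι = algebraMap B C x • LinearMap.id := by
  classical
  let e : C ⊗[B] (Fin s → B) ≃ₗ[C] (Fin s → C) := TensorProduct.piScalarRight B C C (Fin s)
  refine ⟨e.toLinearMap ∘ₗ ι₀.baseChange C, π₀.baseChange C ∘ₗ e.symm.toLinearMap, ?_⟩
  have hbc := baseChange_comp_baseChange_eq_smul_id (C := C) ι₀ π₀ h
  refine LinearMap.ext fun z => ?_
  have hz := LinearMap.congr_fun hbc z
  simp only [LinearMap.comp_apply, LinearEquiv.coe_toLinearMap, LinearEquiv.symm_apply_apply] at hz ⊢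
  exact hz

/-- **`HullDescentStep`** (card A2·H2): let `B → C` be commutative rings, `x ∈ B`, and `Y₀` a
`B`-module with `π₀ ∘ ι₀ = x • id_{Y₀}` through `Bˢ`. Then every retract `N` of the reflexive hull
`(C ⊗_B Y₀)**` (`r ∘ i = id_N`) has `(algebraMap B C x) • id_N` factoring through `Cˢ` — exponent one;
no torsion-freeness, flatness or birationality is needed for this implication. [folklore] -/
theorem exists_comp_eq_smul_id_hullDescentStep {Y₀ : Type u} [AddCommGroup Y₀] [Module B Y₀]
    {x : B} {s : ℕ} (ι₀ : Y₀ →ₗ[B] (Fin s → B)) (π₀ : (Fin s → B) →ₗ[B] Y₀)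
    (h : π₀ ∘ₗ ι₀ = x • LinearMap.id) {N : Type*} [AddCommGroup N] [Module C N]
    (i : N →ₗ[C] Dual C (Dual C (C ⊗[B] Y₀))) (r : Dual C (Dual C (C ⊗[B] Y₀)) →ₗ[C] N)
    (hri : r ∘ₗ i = LinearMap.id) :
    ∃ (ι : N →ₗ[C] (Fin s → C)) (π : (Fin s → C) →ₗ[C] N),
      π ∘ₗ ι = algebraMap B C x • LinearMap.id := by
  obtain ⟨ι₁, π₁, h₁⟩ := exists_comp_eq_smul_id_baseChange C ι₀ π₀ h
  obtain ⟨ι₂, π₂, h₂⟩ := exists_comp_eq_smul_id_dual_dual ι₁ π₁ h₁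
  exact exists_comp_eq_smul_id_of_retract ι₂ π₂ h₂ i r hri

/-- **`HullDescentStep`, `Ext` form**: in the situation of `exists_comp_eq_smul_id_hullDescentStep`,
`algebraMap B C x` kills `Extⁱ_C(N, M)` for every `C`-module `M` and every `i ≥ 1` (stable
annihilation kills positive `Ext`, `smul_ext_eq_zero_of_linearMap_comp_eq_smul_id`). [folklore] -/
theorem smul_ext_eq_zero_of_hullDescentStep {Y₀ : Type u} [AddCommGroup Y₀] [Module B Y₀]
    {x : B} {s : ℕ} (ι₀ : Y₀ →ₗ[B] (Fin s → B)) (π₀ : (Fin s → B) →ₗ[B] Y₀)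
    (h : π₀ ∘ₗ ι₀ = x • LinearMap.id) {N : Type u} [AddCommGroup N] [Module C N]
    (i : N →ₗ[C] Dual C (Dual C (C ⊗[B] Y₀))) (r : Dual C (Dual C (C ⊗[B] Y₀)) →ₗ[C] N)
    (hri : r ∘ₗ i = LinearMap.id) (M : ModuleCat.{u} C) {j : ℕ} (hj : 1 ≤ j)
    (e : Ext.{u} (ModuleCat.of C N) M j) : algebraMap B C x • e = 0 := by
  obtain ⟨ι, π, hιπ⟩ := exists_comp_eq_smul_id_hullDescentStep C ι₀ π₀ h i r hri
  exact smul_ext_eq_zero_of_linearMap_comp_eq_smul_id ι π hιπ M hj e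

end BaseChange

end Summit.ResolutionOfSingularities.ResolutionOfSingularities.Theorems.HomologicalConductor.PersistenceHullTransfer

end
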